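import Mathlib
import Literature.MathematicalPhysics.StatisticalMechanics.OneCrossingMixture
import Summits.AtomisticToContinuum.Crystallization.Theorems.ThreeConeCertificateExactCertificateTransfer1DClassBounds

/-!
# Crux `ExactCertificate` (stmt-AtomisticToContinuum-11959), line `closure-makes-nogap-exact`,
# Transfer skeleton VII (`OneCrossingChainCrystallizes`): stub `stub_chainEnergyContinuous`

Support file for the crux `ThreeConeCertificate.ExactCertificate`, d = 1 Transfer skeleton VII
`Cruxes.ExactCertificate.Transfer1D.OneCrossingChainCrystallizes`.  Skeleton VII produces the
zero-pressure spacing of a pair potential `V(r) = −∫₀^∞ e^{−tr} p(t) dt` of the one-crossing Laplace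
class as a minimiser of the chain energy `e(b) := Σ'_k V((k+1) b)`; this file supplies CONTINUITY:

* `zcont_continuousOn_integral` — the Laplace integral `r ↦ ∫₀^∞ e^{−tr} p(t) dt` is continuous on every
  half-line `(b, ∞)`, `b > 0` (parametric integral dominated by `e^{−tb} |p(t)|`);
* `zcont_continuousOn_V` — hence `V` is continuous on `(0, ∞)`;
* `zcont_continuousOn_chainEnergy` — the chain energy is continuous on `(0, ∞)` (Weierstrass M-test on
  every `(b₀, ∞)`, `b₀ > 0`, with the envelope `|V(r)| ≤ C (2 r⁻³ + M! r^{−(M+1)})` of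
  `classBounds_abs_le` and the antitonicity `classBounds_profile_mono`);
* `stub_chainEnergyContinuous` — the registered stub.

All `[folklore]`.
-/

noncomputable section

namespace Summit.AtomisticToContinuum.Crystallization.Theorems.ThreeConeCertificateExactCertificate.Transfer1D

open Literature.MathematicalPhysics.StatisticalMechanics MeasureTheory Set Filter Topology
open scoped BigOperators

/-! ## From half-lines to `(0, ∞)` -/

/-- Continuity on `(0, ∞)` follows from continuity on every open half-line `(b, ∞)` with `b > 0`
(at `r > 0` use the open neighbourhood `(r/2, ∞)`). [folklore] -/
theorem zcont_continuousOn_Ioi_of_forall {X : Type*} [TopologicalSpace X] {f : ℝ → X}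
    (h : ∀ b : ℝ, 0 < b → ContinuousOn f (Ioi b)) : ContinuousOn f (Ioi 0) := by
  intro r hr
  have hr : (0 : ℝ) < r := hr
  exact ((h (r / 2) (half_pos hr)).continuousAt (Ioi_mem_nhds (half_lt_self hr))).continuousWithinAt

/-! ## Continuity of the Laplace integral and of `V` -/

/-- **Continuity of the Laplace integral.** Under the envelope `|p(t)| ≤ C(t² + t^M)` and measurability
of `p`, the function `r ↦ ∫₀^∞ e^{−tr} p(t) dt` is continuous on `(b, ∞)` for every `b > 0`: on this
half-line the integrand is dominated by the integrable `e^{−tb} |p(t)|`, and it is continuous in `r` for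
each fixed `t`. [folklore] -/
theorem zcont_continuousOn_integral {p : ℝ → ℝ} {C : ℝ} {M : ℕ} (hpm : Measurable p)
    (hbd : ∀ t : ℝ, 0 < t → |p t| ≤ C * (t ^ 2 + t ^ M)) {b : ℝ} (hb : 0 < b) :
    ContinuousOn (fun r : ℝ => ∫ t in Set.Ioi (0 : ℝ), Real.exp (-(t * r)) * p t) (Ioi b) := by
  have hint := (classBounds_integrableOn_zero hpm hbd hb).norm
  refine continuousOn_of_dominated (bound := fun t : ℝ => ‖Real.exp (-(t * b)) * p t‖)
    (fun r _ => ?_) (fun r hr => ?_) hint (Filter.Eventually.of_forall fun t => ?_)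
  · have h1 : Measurable fun t : ℝ => Real.exp (-(t * r)) :=
      Real.continuous_exp.measurable.comp ((measurable_id.mul_const r).neg)
    exact (h1.mul hpm).aestronglyMeasurable
  · have hr : b < r := hr
    refine (ae_restrict_iff' measurableSet_Ioi).2 (Filter.Eventually.of_forall fun t ht => ?_)
    have ht : (0 : ℝ) < t := ht
    simp only [norm_mul, Real.norm_eq_abs, Real.abs_exp]
    exact mul_le_mul_of_nonneg_right
      (Real.exp_le_exp.2 (neg_le_neg (mul_le_mul_of_nonneg_left hr.le ht.le))) (abs_nonneg _)
  · have hc : Continuous fun r : ℝ => Real.exp (-(t * r)) * p t := by fun_prop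
    exact hc.continuousOn

/-- **Continuity of `V`.** With `V(r) = −∫₀^∞ e^{−tr} p(t) dt` on `r > 0`, the envelope and
measurability of `p`, the potential `V` is continuous on `(0, ∞)`. [folklore] -/
theorem zcont_continuousOn_V {V p : ℝ → ℝ} {C : ℝ} {M : ℕ} (hpm : Measurable p)
    (hbd : ∀ t : ℝ, 0 < t → |p t| ≤ C * (t ^ 2 + t ^ M))
    (hV : ∀ r : ℝ, 0 < r → V r = -(∫ t in Set.Ioi (0 : ℝ), Real.exp (-(t * r)) * p t)) :
    ContinuousOn V (Ioi 0) := by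
  refine zcont_continuousOn_Ioi_of_forall fun b hb => ?_
  refine ((zcont_continuousOn_integral hpm hbd hb).neg).congr fun r hr => ?_
  have hr : b < r := hr
  exact hV r (hb.trans hr)

/-! ## Continuity of the chain energy -/

/-- **Continuity of the chain energy.** Under the envelope (`M ≥ 2`), measurability of `p` and the
Laplace representation of `V`, the chain energy `b ↦ Σ'_k V((k+1) b)` is continuous on `(0, ∞)`:
on every half-line `(b₀, ∞)`, `b₀ > 0`, the terms are continuous and uniformly bounded by the summable
`C (2 b₀⁻³ (k+1)⁻³ + M! b₀^{−(M+1)} (k+1)^{−(M+1)})` (Weierstrass M-test). [folklore] -/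
theorem zcont_continuousOn_chainEnergy {V p : ℝ → ℝ} {C : ℝ} {M : ℕ} (hM : 2 ≤ M)
    (hpm : Measurable p) (hbd : ∀ t : ℝ, 0 < t → |p t| ≤ C * (t ^ 2 + t ^ M))
    (hV : ∀ r : ℝ, 0 < r → V r = -(∫ t in Set.Ioi (0 : ℝ), Real.exp (-(t * r)) * p t)) :
    ContinuousOn (fun b : ℝ => ∑' k : ℕ, V (((k : ℝ) + 1) * b)) (Ioi 0) := by
  have hC := classBounds_C_nonneg hbd
  have hVc := zcont_continuousOn_V hpm hbd hV
  refine zcont_continuousOn_Ioi_of_forall fun b₀ hb₀ => ?_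
  -- the dominating summable sequence on the half-line `(b₀, ∞)`
  have hus : Summable (fun k : ℕ => C * (2 * b₀⁻¹ ^ 3 * ((k : ℝ) + 1)⁻¹ ^ 3
      + (M.factorial : ℝ) * b₀⁻¹ ^ (M + 1) * ((k : ℝ) + 1)⁻¹ ^ (M + 1))) :=
    (((classBounds_summable_inv_pow (by norm_num)).mul_left (2 * b₀⁻¹ ^ 3)).add
      ((classBounds_summable_inv_pow (by omega)).mul_left
        ((M.factorial : ℝ) * b₀⁻¹ ^ (M + 1)))).mul_left C
  have hfu : ∀ (k : ℕ) (b : ℝ), b ∈ Ioi b₀ → ‖V (((k : ℝ) + 1) * b)‖ ≤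
      C * (2 * b₀⁻¹ ^ 3 * ((k : ℝ) + 1)⁻¹ ^ 3
        + (M.factorial : ℝ) * b₀⁻¹ ^ (M + 1) * ((k : ℝ) + 1)⁻¹ ^ (M + 1)) := by
    intro k b hb
    have hb : b₀ < b := hb
    have hk : (0 : ℝ) < (k : ℝ) + 1 := by positivity
    have hs : 0 < ((k : ℝ) + 1) * b₀ := mul_pos hk hb₀
    have hsr : ((k : ℝ) + 1) * b₀ ≤ ((k : ℝ) + 1) * b := mul_le_mul_of_nonneg_left hb.le hk.le
    have hr : 0 < ((k : ℝ) + 1) * b := hs.trans_le hsr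
    rw [Real.norm_eq_abs]
    calc |V (((k : ℝ) + 1) * b)|
        ≤ C * (2 * (((k : ℝ) + 1) * b₀)⁻¹ ^ 3
            + (M.factorial : ℝ) * (((k : ℝ) + 1) * b₀)⁻¹ ^ (M + 1)) :=
          (classBounds_abs_le hpm hbd hV hr).trans
            (mul_le_mul_of_nonneg_left (classBounds_profile_mono hs hsr) hC)
      _ = C * (2 * b₀⁻¹ ^ 3 * ((k : ℝ) + 1)⁻¹ ^ 3
            + (M.factorial : ℝ) * b₀⁻¹ ^ (M + 1) * ((k : ℝ) + 1)⁻¹ ^ (M + 1)) := by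
          rw [mul_inv, mul_pow, mul_pow]; ring
  have hf : ∀ k : ℕ, ContinuousOn (fun b : ℝ => V (((k : ℝ) + 1) * b)) (Ioi b₀) := by
    intro k
    have hk : (0 : ℝ) < (k : ℝ) + 1 := by positivity
    have hlin : ContinuousOn (fun b : ℝ => ((k : ℝ) + 1) * b) (Ioi b₀) :=
      (continuous_const.mul continuous_id).continuousOn
    refine hVc.comp hlin fun b hb => ?_
    have hb : b₀ < b := hb
    exact mul_pos hk (hb₀.trans hb)
  exact continuousOn_tsum hf hus hfu

/-! ## The registered stub -/

/-- **STUB `stub_chainEnergyContinuous` — CONTINUITY** (registered stub of Transfer skeleton VII): from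
the envelope `|p(t)| ≤ C(t² + t^M)` (`M ≥ 2`), measurability of `p` and the Laplace representation
`V(r) = −∫₀^∞ e^{−tr} p(t) dt` (`r > 0`), the potential `V` and the chain energy `b ↦ Σ'_k V((k+1) b)` are
continuous on `(0, ∞)`. [folklore] -/
theorem stub_chainEnergyContinuous : ∀ (V p : ℝ → ℝ) (C : ℝ) (M : ℕ), 2 ≤ M → Measurable p →
    (∀ t : ℝ, 0 < t → |p t| ≤ C * (t ^ 2 + t ^ M)) →
    (∀ r : ℝ, 0 < r → V r = -(∫ t in Set.Ioi (0 : ℝ), Real.exp (-(t * r)) * p t)) →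
    ContinuousOn V (Set.Ioi 0) ∧
    ContinuousOn (fun b : ℝ => ∑' k : ℕ, V (((k : ℝ) + 1) * b)) (Set.Ioi 0) := by
  intro V p C M hM hpm hbd hV
  exact ⟨zcont_continuousOn_V hpm hbd hV, zcont_continuousOn_chainEnergy hM hpm hbd hV⟩

end Summit.AtomisticToContinuum.Crystallization.Theorems.ThreeConeCertificateExactCertificate.Transfer1D

end
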